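import Summits.MatrixMultiplication.OmegaCensus.STPP222IcosetHSearch

/-!
# ω-census, icoset class negatives at 2-rank FOUR: the kernel WITNESS-MODEL search engine (recursor form)

HONEST FRAMING (pub-omega census; verbatim): lottery ticket; floor = certified bounds/negative ranges.
Census STRUCTURE bookkeeping (question Q7; the involution-coset class of `(2,2,2)^K` families, `STPP222IcosetCriterion.lean`),
nothing about `ω`.  Pure machinery (no group, no theorem about STPP families): the search that the kernel runs in the class-negative
files for `V = 𝔽₂⁴`; its soundness is `STPP222IcosetWSearchSound.lean`.

WHAT IS SEARCHED (the r = 4 "witness model" of the cell note `HOME/pub-omega-eng2-g28/icoset/ICR-NOTE.md`, ENG2 gen 28, in bit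
coordinates).  Vectors of `V = 𝔽₂⁴` and functionals of `E = V*` are both 4-bit numbers, `u(v) = parity (u AND v)`.  A triple `t` of an
icoset family has an independent frame `(sA_t, sB_t, sC_t)`; dually: the POINT `ψ_t ∈ E ∖ 0` killing the frame and three LINES through
it, `L⁰_t = Ann⟨sA,sB⟩`, `L¹_t = Ann⟨sB,sC⟩`, `L²_t = Ann⟨sA,sC⟩` (pairwise meeting in `ψ_t`, together spanning `E`).  A ZERO `z = (i,j,k)`
(an index triple `≠ (t,t,t)` whose `H`-word vanishes) is rescued iff some WITNESS `u ∈ L⁰_i ∩ L¹_j ∩ L²_k` has `u(off_z) = 1`,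
`off_z = p_i + q_j + p_k + q_k` (`p_t = xA_t + xB_t`, `q_t = xB_t + xC_t`); for a zero with two equal indices the witness is forced
to be `ψ` of the repeated index.  STATE: per triple the known `ψ_t` (or `0`), the witnesses recorded on each of its three lines
(nibble-packed lists), a cached summary (`tripInfo`: admissible-witness masks of the three lines, feasible-`ψ` mask); the reduced
`𝔽₂`-linear system of the witness equations on the `8K` offset bits; the list of zeros still to rescue.  SEARCH: pick the zero with the
fewest admissible witnesses, branch on the witness, update lines / `ψ` / equations, prune on an infeasible triple or an inconsistent
system; `true` = every branch pruned (a leaf with all zeros witnessed returns `false`).  Frame `0` is the standard frame (`ψ_0 = 8`,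
lines `{4,8,12}, {1,8,9}, {2,8,10}`; WLOG by `GL₄(𝔽₂)` — soundness file).  H-STAGE (`H = ZMod n`, data `(β_t, γ_t)` as codes
`n β + γ`, `β₀ = γ₀ = 0`, codes of `t ≥ 1` sorted): zeros, the canonical test (lexicographic minimality over re-basing at any triple
and scaling by units) and the enumeration of all sorted code tuples in chunks.
KERNEL FORM as in `STPP222IcosetHSearch.lean` (seat gen 19): `Nat.rec`/`List.rec` loops, kernel `Nat` arithmetic and bit operations,
`Bool.rec` branching, every computed value that is used twice forced to a literal first (`frc`, `frcL`).
References: H. Cohn, R. Kleinberg, B. Szegedy, C. Umans, FOCS 2005 (arXiv:math/0511460), Def. 5.1 (the STPP behind the class);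
cell note `HOME/pub-omega-eng2-g28/icoset/ICR-NOTE.md` (engine-grade witness model `icw.py` / `icwc.c`).
Seat pub-omega-kernel-l4 (gen 20), 2026-08-27.
-/

namespace Summit.MatrixMultiplication.OmegaCensus

namespace IcosetW

open IcosetH (getI snoc allN)

/-! ## Small `Nat` / list primitives (recursor form) -/

/-- `if b then x else y` on `Bool`, by the recursor. -/
noncomputable def cnd {α : Type} (b : Bool) (x y : α) : α := @Bool.rec (fun _ => α) y x b

/-- Force a natural number to a literal, then continue. -/
noncomputable def frc {α : Type} (n : ℕ) (f : ℕ → α) : α := @Nat.rec (fun _ => α) (f 0) (fun k _ => f (Nat.add k 1)) n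

/-- Deep-force a list of naturals, then continue. -/
noncomputable def frcL {α : Type} (l : List ℕ) (f : List ℕ → α) : α :=
  @List.rec ℕ (fun _ => (List ℕ → α) → α) (fun f => f [])
    (fun x _ ih f => @Nat.rec (fun _ => α) (ih fun xs => f (0 :: xs)) (fun k _ => ih fun xs => f (Nat.add k 1 :: xs)) x) l f

/-- `min x y`. -/
noncomputable def minN (x y : ℕ) : ℕ := cnd (Nat.ble x y) x y

/-- Length of a list. -/
noncomputable def lenL (l : List ℕ) : ℕ := @List.rec ℕ (fun _ => ℕ) 0 (fun _ _ ih => Nat.add ih 1) l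

/-- `n` zeros. -/
noncomputable def zerosL (n : ℕ) : List ℕ := @Nat.rec (fun _ => List ℕ) [] (fun _ ih => 0 :: ih) n

/-- `l` with entry `i` replaced by `v` (no-op beyond the length). -/
noncomputable def setI (l : List ℕ) (i v : ℕ) : List ℕ :=
  @List.rec ℕ (fun _ => ℕ → List ℕ) (fun _ => [])
    (fun x xs ih i => @Nat.rec (fun _ => List ℕ) (v :: xs) (fun j _ => x :: ih j) i) l i

/-- Remove the first occurrence of `z` from `l`. -/
noncomputable def removeI (l : List ℕ) (z : ℕ) : List ℕ :=
  @List.rec ℕ (fun _ => List ℕ) [] (fun x xs ih => cnd (Nat.beq x z) xs (x :: ih)) l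

/-- Number of set bits of a 4-bit number (nibble table `0x4332322132212110`). -/
noncomputable def popc4 (v : ℕ) : ℕ := Nat.mod (Nat.shiftRight 4841987667533046032 (Nat.mul 4 v)) 16

/-- Number of set bits among the low 16 bits. -/
noncomputable def popc16 (m : ℕ) : ℕ :=
  Nat.add (Nat.add (popc4 (Nat.mod m 16)) (popc4 (Nat.mod (Nat.div m 16) 16)))
    (Nat.add (popc4 (Nat.mod (Nat.div m 256) 16)) (popc4 (Nat.mod (Nat.div m 4096) 16)))

/-- `∀ i < 16, bit i of m set → p i`. -/
noncomputable def allBits16 (m : ℕ) (p : ℕ → Bool) : Bool :=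
  @Nat.rec (fun _ => Bool) true (fun i acc => acc && (!(Nat.testBit m i) || p i)) 16

/-- Fold `f` over the nibbles (base-16 digits, least significant first) of `pl`, stopping at `0` (at most 64 digits). -/
noncomputable def nibFold (pl : ℕ) (init : ℕ) (f : ℕ → ℕ → ℕ) : ℕ :=
  @Nat.rec (fun _ => ℕ → ℕ → ℕ) (fun _ acc => acc)
    (fun _ ih pl acc => cnd (Nat.beq pl 0) acc
      (frc (Nat.mod pl 16) fun v => frc (f v acc) fun acc' => ih (Nat.div pl 16) acc')) 64 pl init

/-! ## `𝔽₂⁴` in bits: vectors and functionals are `0 … 15`, `u(v) = parity (u AND v)` -/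

/-- Parity of the popcount of a 4-bit number (table `0x6996`). -/
noncomputable def par4 (x : ℕ) : Bool := Nat.testBit 27030 x

/-- Evaluation of the functional `u` at the vector `v`. -/
noncomputable def ev (u v : ℕ) : Bool := par4 (Nat.land u v)

/-- Representative of the coset `q + {0, ψ}` in `E/⟨ψ⟩`: `min q (q ⊕ ψ)`. -/
noncomputable def rep (q ψ : ℕ) : ℕ := minN q (Nat.xor q ψ)

/-- `2^i`. -/
noncomputable def bit (i : ℕ) : ℕ := Nat.shiftLeft 1 i

/-- Bit mask of the line through `ψ` with coset representative `l`: `{ψ, l, l ⊕ ψ}`. -/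
noncomputable def lineM (ψ l : ℕ) : ℕ := Nat.lor (Nat.lor (bit ψ) (bit l)) (bit (Nat.xor l ψ))

/-- All fifteen points (bits `1 … 15`). -/
noncomputable def allPts : ℕ := 65534

/-- The coset representative `λ` common to all recorded points `≠ ψ` of one line (`0` = none recorded), or `16` = CONFLICT
(two recorded points in different cosets of `⟨ψ⟩`, i.e. not on one line through `ψ`). -/
noncomputable def lamOf (ψ pl : ℕ) : ℕ :=
  nibFold pl 0 fun v acc =>
    cnd (Nat.beq acc 16) 16 (cnd (Nat.beq v ψ) acc
      (frc (rep v ψ) fun l => cnd (Nat.beq acc 0) l (cnd (Nat.beq acc l) acc 16)))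

/-- Mask of the line with own representative `l`, given the other two lines' representatives `la lb` (`0` = undetermined):
a determined line is its three points; an undetermined one avoids the other determined lines off `ψ` and, if both others are
determined, the two points that would make the three lines coplanar. -/
noncomputable def lineMask (ψ l la lb : ℕ) : ℕ :=
  cnd (Nat.beq l 0)
    (frc (cnd (Nat.beq la 0) allPts (Nat.xor allPts (Nat.xor (lineM ψ la) (bit ψ)))) fun m1 =>
     frc (cnd (Nat.beq lb 0) m1 (Nat.land m1 (Nat.xor allPts (Nat.xor (lineM ψ lb) (bit ψ))))) fun m2 =>
     cnd (Nat.beq la 0 || Nat.beq lb 0) m2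
       (Nat.land m2 (Nat.xor allPts (Nat.lor (bit (Nat.xor la lb)) (bit (Nat.xor (Nat.xor la lb) ψ))))))
    (lineM ψ l)

/-- Admissible-witness masks of the three lines of a triple with point `ψ` and recorded point lists `p0 p1 p2`, packed
`M0 + M1·2¹⁶ + M2·2³² + 2⁴⁸` (positive); `0` = the recorded points fit NO frame with this `ψ`. -/
noncomputable def masksAt (ψ p0 p1 p2 : ℕ) : ℕ :=
  frc (lamOf ψ p0) fun l0 => frc (lamOf ψ p1) fun l1 => frc (lamOf ψ p2) fun l2 =>
  cnd (Nat.beq l0 16 || Nat.beq l1 16 || Nat.beq l2 16 ||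
      (!(Nat.beq l0 0) && Nat.beq l0 l1) || (!(Nat.beq l1 0) && Nat.beq l1 l2) || (!(Nat.beq l0 0) && Nat.beq l0 l2) ||
      (!(Nat.beq l0 0) && !(Nat.beq l1 0) && !(Nat.beq l2 0) &&
        (Nat.beq (Nat.xor (Nat.xor l0 l1) l2) 0 || Nat.beq (Nat.xor (Nat.xor l0 l1) l2) ψ)))
    0
    (Nat.add (Nat.add (lineMask ψ l0 l1 l2) (Nat.add (Nat.mul (lineMask ψ l1 l0 l2) 65536)
      (Nat.mul (lineMask ψ l2 l0 l1) 4294967296))) 281474976710656)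

/-- FEASIBLE-`ψ` MASK of a triple with unknown `ψ`: bit `c` (`1 ≤ c ≤ 15`) set iff the recorded points fit some frame with
`ψ = c` (`masksAt c ≠ 0`). -/
noncomputable def feasF (p0 p1 p2 : ℕ) : ℕ :=
  @Nat.rec (fun _ => ℕ) 0 (fun c acc => frc acc fun acc =>
    cnd (Nat.beq (masksAt (Nat.add c 1) p0 p1 p2) 0) acc (Nat.lor acc (bit (Nat.add c 1)))) 15

/-- Some set bit among bits `0 … 15` (the highest; `0` if none). -/
noncomputable def someBit (F : ℕ) : ℕ := @Nat.rec (fun _ => ℕ) 0 (fun c acc => cnd (Nat.testBit F c) c acc) 16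

/-- All three admissible masks = all fifteen points, packed. -/
noncomputable def allM : ℕ := Nat.add (Nat.add allPts (Nat.mul allPts 65536)) (Nat.mul allPts 4294967296)

/-- Pack a triple summary: masks `M < 2⁴⁸`, point `ψ'`, feasible mask `F`; `+ 2⁶⁸` makes it positive. -/
noncomputable def tiPack (M ψ' F : ℕ) : ℕ :=
  Nat.add (Nat.add (Nat.add M (Nat.mul ψ' 281474976710656)) (Nat.mul F 4503599627370496)) 295147905179352825856

/-- TRIPLE SUMMARY.  Input: known `ψ` (`0` = unknown) and the three recorded point lists.  Output `0` = DEAD (no frame fits);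
otherwise `tiPack M ψ' F`: `F` = mask of the feasible `ψ`, `ψ'` = the known or FORCED `ψ` (`0` if still ambiguous), `M` = the packed
admissible-witness masks of the three lines for `ψ'` (all points if `ψ` is still ambiguous). -/
noncomputable def tripInfo (ψ p0 p1 p2 : ℕ) : ℕ :=
  cnd (Nat.beq ψ 0)
    (frc (feasF p0 p1 p2) fun F =>
      cnd (Nat.beq F 0) 0
        (cnd (Nat.beq (popc16 F) 1)
          (frc (someBit F) fun ψ' => frc (masksAt ψ' p0 p1 p2) fun r => tiPack (Nat.mod r 281474976710656) ψ' F)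
          (tiPack allM 0 F)))
    (frc (masksAt ψ p0 p1 p2) fun r => cnd (Nat.beq r 0) 0 (tiPack (Nat.mod r 281474976710656) ψ (bit ψ)))

/-- Field `M0` (admissible witnesses on line `0`) of a triple summary. -/
noncomputable def tiM0 (r : ℕ) : ℕ := Nat.mod r 65536
/-- Field `M1` of a triple summary. -/
noncomputable def tiM1 (r : ℕ) : ℕ := Nat.mod (Nat.div r 65536) 65536
/-- Field `M2` of a triple summary. -/
noncomputable def tiM2 (r : ℕ) : ℕ := Nat.mod (Nat.div r 4294967296) 65536
/-- Field `ψ'` of a triple summary. -/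
noncomputable def tiPsi (r : ℕ) : ℕ := Nat.mod (Nat.div r 281474976710656) 16
/-- Field `F` (feasible `ψ`) of a triple summary. -/
noncomputable def tiF (r : ℕ) : ℕ := Nat.mod (Nat.div r 4503599627370496) 65536

/-! ## The `𝔽₂`-linear system of the witness equations (`8K` offset bits: bit `8t + e` = bit `e` of `p_t`, bit `8t + 4 + e` of `q_t`) -/

/-- Coefficient row of the equation `u(p_i + q_j + p_k + q_k) = 1`. -/
noncomputable def eqRow (u i j k : ℕ) : ℕ :=
  Nat.xor (Nat.xor (Nat.shiftLeft u (Nat.mul 8 i)) (Nat.shiftLeft u (Nat.add (Nat.mul 8 j) 4)))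
    (Nat.xor (Nat.shiftLeft u (Nat.mul 8 k)) (Nat.shiftLeft u (Nat.add (Nat.mul 8 k) 4)))

/-- Lowest set bit of `x < 2⁶³`, as a power of two (`0` for `x = 0`). -/
noncomputable def lowBit (x : ℕ) : ℕ := Nat.land x (Nat.sub 9223372036854775808 x)

/-- Reduce `r` by the rows `R` (a row's pivot = its lowest coefficient bit; coefficient bits = `cmask`). -/
noncomputable def reduceRow (R : List ℕ) (cmask r : ℕ) : ℕ :=
  @List.rec ℕ (fun _ => ℕ → ℕ) (fun r => r)
    (fun x _ ih r => frc (cnd (Nat.beq (Nat.land r (lowBit (Nat.land x cmask))) 0) r (Nat.xor r x)) fun r' => ih r') R r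

/-- Add the equation `row · x = 1` (right-hand side stored at bit `RB`): result `0 :: R'` (consistent, new row list `R'`) or
`[1]` (INCONSISTENT: the equation reduces to `0 = 1`). -/
noncomputable def addEq (R : List ℕ) (RB row : ℕ) : List ℕ :=
  frc (Nat.sub (bit RB) 1) fun cmask =>
  frc (reduceRow R cmask (Nat.lor row (bit RB))) fun r =>
    cnd (Nat.beq (Nat.land r cmask) 0) (cnd (Nat.beq r 0) (0 :: R) [1]) (0 :: snoc R r)

/-! ## Zeros, candidates, selection -/

/-- Zero code `64 i + 8 j + k` ↦ `i`. -/
noncomputable def zi (z : ℕ) : ℕ := Nat.div z 64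
/-- Zero code ↦ `j`. -/
noncomputable def zj (z : ℕ) : ℕ := Nat.mod (Nat.div z 8) 8
/-- Zero code ↦ `k`. -/
noncomputable def zk (z : ℕ) : ℕ := Nat.mod z 8

/-- The repeated index of a two-equal-index zero, `+ 1` (`0` = all three indices distinct). -/
noncomputable def zrep (z : ℕ) : ℕ :=
  cnd (Nat.beq (zj z) (zk z)) (Nat.add (zj z) 1) (cnd (Nat.beq (zi z) (zj z) || Nat.beq (zi z) (zk z)) (Nat.add (zi z) 1) 0)

/-- Candidate-witness mask of the zero `z` (`TI` = triple summaries). -/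
noncomputable def candM (TI : List ℕ) (z : ℕ) : ℕ :=
  frc (Nat.land (Nat.land (tiM0 (getI TI (zi z))) (tiM1 (getI TI (zj z)))) (tiM2 (getI TI (zk z)))) fun m =>
  frc (zrep z) fun r => cnd (Nat.beq r 0) m (Nat.land m (tiF (getI TI (Nat.sub r 1))))

/-- Select the zero of `TD ≠ []` with the fewest candidates: `cnt·2²⁸ + z·2¹⁶ + cm` for the FIRST minimiser. -/
noncomputable def select (TI TD : List ℕ) : ℕ :=
  @List.rec ℕ (fun _ => ℕ → ℕ) (fun best => best)
    (fun z _ ih best => frc (candM TI z) fun cm => frc (popc16 cm) fun c =>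
      frc (cnd (Nat.blt c (Nat.div best 268435456)) (Nat.add (Nat.add (Nat.mul c 268435456) (Nat.mul z 65536)) cm) best)
        fun best' => ih best')
    TD 4563402752

/-! ## The search -/

/-- Recompute the summary of triple `t`; continue with the updated `(PS, TI)`, or return `true` (pruned) if the triple is dead. -/
noncomputable def refresh (PS PL TI : List ℕ) (t : ℕ) (k : List ℕ → List ℕ → Bool) : Bool :=
  frc (tripInfo (getI PS t) (getI PL (Nat.mul 3 t)) (getI PL (Nat.add (Nat.mul 3 t) 1)) (getI PL (Nat.add (Nat.mul 3 t) 2)))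
    fun r => cnd (Nat.beq r 0) true (frcL (setI PS t (tiPsi r)) fun PS' => frcL (setI TI t r) fun TI' => k PS' TI')

/-- One CHILD of the search node: witness `u` for the zero `z`; `rec` = the search below. -/
noncomputable def child (K : ℕ) (rec : List ℕ → List ℕ → List ℕ → List ℕ → List ℕ → Bool)
    (PS PL TI RW TD : List ℕ) (z u : ℕ) : Bool :=
  frc (zrep z) fun r =>
  frcL (cnd (Nat.beq r 0) PS (setI PS (Nat.sub r 1) u)) fun PS1 =>
  frcL (setI PL (Nat.mul 3 (zi z)) (Nat.add (Nat.mul (getI PL (Nat.mul 3 (zi z))) 16) u)) fun PL1 =>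
  frcL (setI PL1 (Nat.add (Nat.mul 3 (zj z)) 1) (Nat.add (Nat.mul (getI PL1 (Nat.add (Nat.mul 3 (zj z)) 1)) 16) u)) fun PL2 =>
  frcL (setI PL2 (Nat.add (Nat.mul 3 (zk z)) 2) (Nat.add (Nat.mul (getI PL2 (Nat.add (Nat.mul 3 (zk z)) 2)) 16) u)) fun PL3 =>
  frcL (addEq RW (Nat.mul 8 K) (eqRow u (zi z) (zj z) (zk z))) fun RW1 =>
    @List.rec ℕ (fun _ => Bool) true (fun flag RW' _ =>
      cnd (Nat.beq flag 1) true
        (refresh PS1 PL3 TI (zi z) fun PS2 TI2 => refresh PS2 PL3 TI2 (zj z) fun PS3 TI3 =>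
          refresh PS3 PL3 TI3 (zk z) fun PS4 TI4 => frcL (removeI TD z) fun TD' => rec PS4 PL3 TI4 RW' TD')) RW1

/-- THE SEARCH.  `dfs K fuel PS PL TI RW TD`: `true` iff every completion of the state is pruned (`false` at a leaf with no zero
left, and when the fuel is exhausted). -/
noncomputable def dfs (K : ℕ) : ℕ → List ℕ → List ℕ → List ℕ → List ℕ → List ℕ → Bool :=
  fun fuel => @Nat.rec (fun _ => List ℕ → List ℕ → List ℕ → List ℕ → List ℕ → Bool) (fun _ _ _ _ _ => false)
    (fun _ rec PS PL TI RW TD =>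
      @List.rec ℕ (fun _ => Bool) false (fun _ _ _ =>
        frc (select TI TD) fun sel =>
          cnd (Nat.beq (Nat.div sel 268435456) 0) true
            (frc (Nat.mod (Nat.div sel 65536) 4096) fun z =>
              allBits16 (Nat.mod sel 65536) fun u => child K rec PS PL TI RW TD z u)) TD)
    fuel

/-- ROOT: `K` triples, frame `0` standard (`ψ_0 = 8`; points `12,4 | 9,1 | 10,2` recorded on its lines), zero list `TD`;
`true` = REFUTED (no `𝔽₂⁴`-icoset datum whose zero set contains `TD` rescues all of `TD`). -/
noncomputable def vrefute (K : ℕ) (TD : List ℕ) : Bool :=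
  frcL (76 :: 25 :: 42 :: zerosL (Nat.mul 3 (Nat.sub K 1))) fun PL0 =>
  @Nat.rec (fun _ => List ℕ → List ℕ → Bool) (fun PS TI => dfs K (Nat.add (lenL TD) 1) PS PL0 TI [] TD)
    (fun t ih PS TI => refresh PS PL0 TI t fun PS' TI' => ih PS' TI') K (8 :: zerosL (Nat.sub K 1)) (zerosL K)

/-! ## H-stage for `H = ZMod n`, data `(β_t, γ_t)` as codes `n·β + γ` (`β, γ < n`) -/

/-- Zero test of the ordered index triple `(i, j, k)`: `β_j − β_i + γ_k − γ_j ≡ 0 (mod n)` (`C` = code list). -/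
noncomputable def isZero (n : ℕ) (C : List ℕ) (i j k : ℕ) : Bool :=
  Nat.beq (Nat.mod (Nat.add (Nat.add (Nat.div (getI C j) n) (Nat.mod (getI C k) n))
    (Nat.sub (Nat.mul 2 n) (Nat.add (Nat.div (getI C i) n) (Nat.mod (getI C j) n)))) n) 0

/-- The zero codes `64 i + 8 j + k` of all `(i, j, k) ≠ (t, t, t)`, `i, j, k < K ≤ 8`, in increasing order. -/
noncomputable def zerosOf (n K : ℕ) (C : List ℕ) : List ℕ :=
  @Nat.rec (fun _ => List ℕ) [] (fun m acc =>
    frc (Nat.sub 511 m) fun z =>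
      cnd (Nat.blt (zi z) K && Nat.blt (zj z) K && Nat.blt (zk z) K && !(Nat.beq (zi z) (zj z) && Nat.beq (zj z) (zk z)) &&
            isZero n C (zi z) (zj z) (zk z)) (z :: acc) acc) 512

/-- Insert `x` into the sorted list `l`. -/
noncomputable def insSorted (x : ℕ) (l : List ℕ) : List ℕ :=
  @List.rec ℕ (fun _ => List ℕ) [x] (fun y ys ih => cnd (Nat.ble x y) (x :: y :: ys) (y :: ih)) l

/-- The sorted code list of `C` re-based at triple `b` and scaled by `u`: codes `n·(u(β_t − β_b) mod n) + (u(γ_t − γ_b) mod n)`,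
`t ≠ b`, `t < K`. -/
noncomputable def rebased (n K : ℕ) (C : List ℕ) (b u : ℕ) : List ℕ :=
  frc (Nat.div (getI C b) n) fun bb => frc (Nat.mod (getI C b) n) fun gb =>
  @Nat.rec (fun _ => List ℕ) [] (fun t acc => frcL acc fun acc =>
    cnd (Nat.beq t b) acc
      (insSorted (Nat.add (Nat.mul n (Nat.mod (Nat.mul u (Nat.add (Nat.div (getI C t) n) (Nat.sub n bb))) n))
          (Nat.mod (Nat.mul u (Nat.add (Nat.mod (getI C t) n) (Nat.sub n gb))) n)) acc)) K

/-- Lexicographic `l₁ < l₂` (a proper prefix is smaller). -/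
noncomputable def lexLt (l₁ l₂ : List ℕ) : Bool :=
  @List.rec ℕ (fun _ => List ℕ → Bool) (fun l₂ => @List.rec ℕ (fun _ => Bool) false (fun _ _ _ => true) l₂)
    (fun x _ ih l₂ => @List.rec ℕ (fun _ => Bool) false (fun y ys _ => Nat.blt x y || (Nat.beq x y && ih ys)) l₂) l₁ l₂

/-- Tail of a list. -/
noncomputable def tailL (l : List ℕ) : List ℕ := @List.rec ℕ (fun _ => List ℕ) [] (fun _ xs _ => xs) l

/-- CANONICAL TEST: no re-basing `b < K` and unit `u ∈ U` gives a lexicographically smaller sorted code list than the codes of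
`t = 1 … K−1` (`C = 0 :: those`). -/
noncomputable def canon (n K : ℕ) (U : List ℕ) (C : List ℕ) : Bool :=
  frcL (tailL C) fun tl =>
  allN K fun b => @List.rec ℕ (fun _ => Bool) true (fun u _ ih => ih && !(lexLt (rebased n K C b u) tl)) U

/-- ONE H-CLASS: not canonical, or refuted by the witness search. -/
noncomputable def classOk (n K : ℕ) (U : List ℕ) (C : List ℕ) : Bool :=
  !(canon n K U C) || frcL (zerosOf n K C) fun TD => vrefute K TD

/-- Every sorted code tuple extending the prefix `pre` (codes so far, INCLUDING the leading `0` of triple `0`) by `r` more codes,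
each `≥ lo` and `< n²`, gives an OK class. -/
noncomputable def allTuples (n K : ℕ) (U : List ℕ) : ℕ → ℕ → List ℕ → Bool :=
  fun r => @Nat.rec (fun _ => ℕ → List ℕ → Bool) (fun _ pre => classOk n K U pre)
    (fun _ rec lo pre => allN (Nat.mul n n) fun c => Nat.blt c lo || frcL (snoc pre c) fun pre' => rec c pre') r

/-- CHUNK: all classes with `c₁ = c1` and `c2lo ≤ c₂ < c2hi` (`c₂ ≥ c₁`), `K ≥ 3`. -/
noncomputable def chunk (n K : ℕ) (U : List ℕ) (c1 c2lo c2hi : ℕ) : Bool :=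
  allN c2hi fun c2 => Nat.blt c2 c2lo || Nat.blt c2 c1 || allTuples n K U (Nat.sub K 3) c2 [0, c1, c2]

/-- SUB-CHUNK: all classes with `c₁ = c1`, `c₂ = c2` and `c3lo ≤ c₃ < c3hi` (`c₃ ≥ c₂`), `K ≥ 4`. -/
noncomputable def chunk3 (n K : ℕ) (U : List ℕ) (c1 c2 c3lo c3hi : ℕ) : Bool :=
  allN c3hi fun c3 => Nat.blt c3 c3lo || Nat.blt c3 c2 || allTuples n K U (Nat.sub K 4) c3 [0, c1, c2, c3]

end IcosetW

end Summit.MatrixMultiplication.OmegaCensus
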